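import Summits.CriticalPhenomena.Ising3D.Control2DL11TwoSided037
import Summits.CriticalPhenomena.Ising3D.Control2DL11GapA
import Summits.CriticalPhenomena.Ising3D.Control2DL13BoxK
import Summits.CriticalPhenomena.Ising3D.Control2DL13BoxL
import Summits.CriticalPhenomena.Ising3D.Control2DL13BoxM
import Summits.CriticalPhenomena.Ising3D.Control2DL13BoxN
import Mathlib.Tactic.NormNum
import HarnessLib

/-!
# The Λ ≤ 13 class-1 window in the kernel: `0.94 < Δ_ε < 1.0006` at `Δ_σ = 1/8` under `A2D′` (window `Δ_ε ≥ 0.37`)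
(cell `pub-ising3x`, seat controls-1 gen 17; KERNEL PATH for the 2D γ-certificates, Λ = 13 class-1 cover — CONTROL-ONLY)

HONEST FRAMING: lottery ticket; floor = tightest certified 3D Ising CFT bounds; no exact-solution
claim without a proof. CONTROL-ONLY (`d = 2`, `Δ_σ = 1/8`, axiom set `A2D′`: `σ × σ` scalars = the `ε` location
`∪ [2, ∞)`, stress tensor `(2,2)` + spin-2 gap `1`, unitarity); nothing about `d = 3`; weaker than the reader-certified
statement of record (`0.99 < Δ_ε < 1.00005`, Λ = 19, readers A ∧ B).

The four RB-2 Λ = 13 / E₀ = 32 kind-`box` certificates K `[9/10, 23/25]`, L `[23/25, 93/100]`, M `[93/100, 187/200]`,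
N `[187/200, 47/50]` (kernel-complete: `Control2DL13Box{K,L,M,N}`) chained onto the Λ = 11 cover
`excludedOn_2d_L11_cover037` (`[37/100, 181/200]`, g16):
* `excludedOn_2d_L13_cover094 : ExcludedOn (1/8) 2 1 (Icc (37/100) (47/50))`;
* `twoSided_2d_L13_kernel : TwoSided (1/8) 2 1 (37/100) (47/50) (5003/5000)` — with the kernel-complete RB-1 Λ = 11 gap
  certificate `gapExcluded_2d_L11_gapA` (g16): under `A2D′` at `Δ_σ = 1/8` an `ε` location `x ≥ 0.37` lies in
  `(0.94, 1.0006)` (2D Ising: `Δ_ε = 1`). Every inequality — (I), (R), every spin cell of 15 functionals — re-decided by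
  the Lean kernel; zero grant compute. No facts, standard axioms only.
-/

namespace Summit.CriticalPhenomena.Ising3D.Control2D

open Set
open Literature.MathematicalPhysics.QuantumFieldTheory.ConformalBootstrap3D

/-- **Kernel-complete cover of the `ε` locations `[37/100, 47/50]`** at `Δ_σ = 1/8` under `A2D′` (RB-2 Λ = 11 boxes
B–J and Λ = 13 boxes K–N). CONTROL-ONLY (d = 2). [cite: RattazziEtAl2008, §5.5] -/
theorem excludedOn_2d_L13_cover094 : ExcludedOn (1 / 8 : ℝ) 2 1 (Icc (37 / 100 : ℝ) (47 / 50)) :=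
  excludedOn_Icc_append
    (excludedOn_Icc_append
      (excludedOn_Icc_append
        (excludedOn_Icc_append excludedOn_2d_L11_cover037 excludedOn_2d_L13_boxK (by norm_num))
        excludedOn_2d_L13_boxL le_rfl)
      excludedOn_2d_L13_boxM le_rfl)
    excludedOn_2d_L13_boxN le_rfl

/-- **2D control, class 1, kernel-complete, Λ ≤ 13**: under `A2D′` at `Δ_σ = 1/8` an `ε` location `x ≥ 37/100`
satisfies `47/50 < x < 5003/5000`. CONTROL-ONLY (d = 2). [cite: RattazziEtAl2008, §5.5] -/
theorem twoSided_2d_L13_kernel : TwoSided (1 / 8 : ℝ) 2 1 (37 / 100) (47 / 50) (5003 / 5000) :=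
  twoSided_of_cover excludedOn_2d_L13_cover094 gapExcluded_2d_L11_gapA (by norm_num)

end Summit.CriticalPhenomena.Ising3D.Control2D
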